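import Summits.Ventures.PercRepro.MSTightInstance
import Summits.Ventures.PercRepro.MSTightBlockLemma

/-!
# The data at the outside vertices of a residue instance: `ρ^*`, the hypotheses of the block
# lemma, and (BNT) for every residue instance (Addendum 39, Step 1)

Dossier proofs/MINE1-theoremS.md, Addendum 39 (Step 1), and proofs/MINE1-RSTARM-PROOF.md §5
(Lemma C). For an instance `RInst S L' T u` (MSTightInstance.lean) write `upSet S L'` for its
up-set `U = {x : S ∖ x ∈ L'}` and `cpx T` for the complex `↓T`. In the RESIDUE case (`T` not
tight) with no singleton of `ū` in `U` (`S.erase m ∉ L'` for every `m ∈ S ∖ u`), every outside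
vertex `m ∈ ⋃T` is a non-tightening direction with nonempty partner family `K_m` (MSTightInstance),
and `ρ^* := {a ∈ u : a ∈ R*(K_m) for every outside vertex m of a member}` (`rho S u T`) satisfies
the two hypotheses of the block lemma (MSTightBlockLemma.lean):
* `exists_subset_rho` (`hZ`): every member of `U` inside `u` contains a member of `U` inside `ρ^*`
  — a minimal one lies in `R*(K_m)` for every `m` by (F7);
* `outside_data` (`hout`): every member `y ⊄ u` has an outside vertex `m ∈ y` with the (NT) data and
  `ρ^* ⊆ u ∩ R*(K_m)`.
Hence **(BNT)** holds in every residue instance: `|Λ ∩ 𝒬| ≤ |K⁺|`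
(`card_link_inter_outFaces_le`), with `Λ = link U u` the link of `ū` and `𝒬 = outFaces T u`,
`K⁺ = T_u ∩ 𝒬`. Also: the minimal members of `U` inside `u` are members of `T`
(`exists_mem_subset_of_mem_upSet`, the hypothesis `hmin` of (S1)).
-/

namespace PercRepro.MSTight

open Finset
open scoped FinsetFamily

variable {α : Type*} [DecidableEq α] [Fintype α]

/-- The up-set of an instance on `S`: the sets whose `S`-complement lies in `L'`. -/
def upSet (S : Finset α) (L' : Finset (Finset α)) : Finset (Finset α) :=
  univ.filter fun x => S \ x ∈ L'

/-- Membership in `upSet`. -/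
theorem mem_upSet {S x : Finset α} {L' : Finset (Finset α)} : x ∈ upSet S L' ↔ S \ x ∈ L' := by
  simp [upSet]

/-- The complex of a family: all sets below a member. -/
def cpx (T : Finset (Finset α)) : Finset (Finset α) := univ.filter fun x => ∃ t ∈ T, x ⊆ t

/-- Membership in `cpx`. -/
theorem mem_cpx {T : Finset (Finset α)} {x : Finset α} : x ∈ cpx T ↔ ∃ t ∈ T, x ⊆ t := by
  simp [cpx]

/-- Subsets of members lie in the complex. -/
theorem mem_cpx_of_subset {T : Finset (Finset α)} {t x : Finset α} (ht : t ∈ T) (hx : x ⊆ t) :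
    x ∈ cpx T := mem_cpx.2 ⟨t, ht, hx⟩

/-- The set `ρ^*`: the vertices of `u` lying in `R*(K_m)` for every outside vertex `m` of a
member. -/
def rho (S u : Finset α) (T : Finset (Finset α)) : Finset α :=
  u.filter fun a => ∀ m ∈ S \ u, (∃ y ∈ T, m ∈ y) → a ∈ Rstar (partner m T)

/-- Membership in `rho`. -/
theorem mem_rho {S u : Finset α} {T : Finset (Finset α)} {a : α} :
    a ∈ rho S u T ↔ a ∈ u ∧ ∀ m ∈ S \ u, (∃ y ∈ T, m ∈ y) → a ∈ Rstar (partner m T) := by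
  simp [rho]

namespace RInst

variable {S u : Finset α} {L' T : Finset (Finset α)}

/-- `U` is an up-set. -/
theorem upSet_up (h : RInst S L' T u) :
    ∀ x ∈ upSet S L', ∀ x', x ⊆ x' → x' ∈ upSet S L' := by
  intro x hx x' hxx'
  rw [mem_upSet] at hx ⊢
  exact h.hdown _ hx _ (sdiff_subset_sdiff (subset_refl S) hxx')

/-- `T ⊆ U`. -/
theorem subset_upSet (h : RInst S L' T u) : T ⊆ upSet S L' :=
  fun y hy => mem_upSet.2 (h.hTU y hy)

/-- `U ∩ ↓T ⊆ T` ((F2)). -/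
theorem mem_of_mem_upSet (h : RInst S L' T u) :
    ∀ x ∈ upSet S L', (∃ t ∈ T, x ⊆ t) → x ∈ T := by
  intro x hx hxt
  obtain ⟨t, ht, hxt'⟩ := id hxt
  exact h.mem_of_compl_mem (hxt'.trans (h.hTS t ht)) (mem_upSet.1 hx) hxt

/-- `u ∈ U`. -/
theorem mem_upSet_self (h : RInst S L' T u) : u ∈ upSet S L' := mem_upSet.2 h.huU

/-- `u` is not in the complex. -/
theorem not_mem_cpx (h : RInst S L' T u) : u ∉ cpx T := by
  intro hu
  obtain ⟨t, ht, hut⟩ := mem_cpx.1 hu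
  exact h.not_subset_of_mem ht hut

/-- A minimal member of `U` below a member of `U`. -/
theorem exists_minimal_upSet {x : Finset α} (hx : x ∈ upSet S L') :
    ∃ z ∈ upSet S L', z ⊆ x ∧ ∀ x', S \ x' ∈ L' → x' ⊆ z → x' = z := by
  obtain ⟨z, hz, hzmin⟩ := exists_min_image ((upSet S L').filter fun z => z ⊆ x) card
    ⟨x, mem_filter.2 ⟨hx, subset_refl x⟩⟩
  rw [mem_filter] at hz
  refine ⟨z, hz.1, hz.2, ?_⟩
  intro x' hx' hx'z
  have := hzmin x' (mem_filter.2 ⟨mem_upSet.2 hx', hx'z.trans hz.2⟩)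
  exact eq_of_subset_of_card_le hx'z this

/-- **(F7) applied to a minimal member.** In the residue case with no singleton of `ū` in `U`
and an outside member, every member of `U` inside `u` contains a member of `T` (the hypothesis
`hmin` of (S1)). -/
theorem exists_mem_subset_of_mem_upSet (h : RInst S L' T u) (hnt : ¬ Tight T)
    (hB : ∀ m ∈ S \ u, S.erase m ∉ L') (hout : ∃ y ∈ T, ¬ y ⊆ u) :
    ∀ x ∈ upSet S L', x ⊆ u → ∃ z ∈ T, z ⊆ x := by
  intro x hx hxu
  obtain ⟨z, hz, hzx, hzmin⟩ := exists_minimal_upSet hx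
  obtain ⟨y, hy, hyu⟩ := hout
  obtain ⟨m, hmy, hmu⟩ := not_subset.1 hyu
  have hmS : m ∈ S \ u := mem_sdiff.2 ⟨h.hTS y hy hmy, hmu⟩
  have := h.mem_partner_and_subset_Rstar_of_minimal hnt hmu (hB m hmS) hy hmy (hzx.trans hxu)
    (mem_upSet.1 hz) (fun x' _ hx' hx'z => hzmin x' hx' hx'z)
  exact ⟨z, mem_of_mem_partner this.1, hzx⟩

/-- **`hZ`.** In the residue case with no singleton of `ū` in `U`, every member of `U` inside `u`
contains a member of `U` inside `ρ^*`. -/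
theorem exists_subset_rho (h : RInst S L' T u) (hnt : ¬ Tight T)
    (hB : ∀ m ∈ S \ u, S.erase m ∉ L') :
    ∀ x ∈ upSet S L', x ⊆ u → ∃ z ∈ upSet S L', z ⊆ x ∧ z ⊆ rho S u T := by
  intro x hx hxu
  obtain ⟨z, hz, hzx, hzmin⟩ := exists_minimal_upSet hx
  refine ⟨z, hz, hzx, ?_⟩
  intro a ha
  rw [mem_rho]
  refine ⟨hxu (hzx ha), ?_⟩
  rintro m hm ⟨y, hy, hmy⟩
  have := h.mem_partner_and_subset_Rstar_of_minimal hnt (mem_sdiff.1 hm).2 (hB m hm) hy hmy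
    (hzx.trans hxu) (mem_upSet.1 hz) (fun x' _ hx' hx'z => hzmin x' hx' hx'z)
  exact this.2 ha

/-- **`hout`.** In the residue case with no singleton of `ū` in `U`, every member `y ⊄ u` has an
outside vertex `m ∈ y` which is a non-tightening direction with nonempty partner family and
`ρ^* ⊆ u ∩ R*(K_m)`. -/
theorem outside_data (h : RInst S L' T u) (hnt : ¬ Tight T)
    (hB : ∀ m ∈ S \ u, S.erase m ∉ L') :
    ∀ y ∈ T, ¬ y ⊆ u → ∃ m ∈ y,
      (diffsX m T ∩ diffsY m T).card = (partner m T).card ∧ (partner m T).Nonempty ∧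
      rho S u T ⊆ u ∩ Rstar (partner m T) := by
  intro y hy hyu
  obtain ⟨m, hmy, hmu⟩ := not_subset.1 hyu
  have hmS : m ∈ S \ u := mem_sdiff.2 ⟨h.hTS y hy hmy, hmu⟩
  refine ⟨m, hmy, h.nonTightening hnt hmu (hB m hmS),
    h.partner_nonempty hnt hmu (hB m hmS) hy hmy, ?_⟩
  intro a ha
  rw [mem_rho] at ha
  exact mem_inter.2 ⟨ha.1, ha.2 m hmS ⟨y, hy, hmy⟩⟩

/-- The same data with `m ∉ u` recorded (the form used by MSTightNoMemberW.lean). -/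
theorem outside_data' (h : RInst S L' T u) (hnt : ¬ Tight T)
    (hB : ∀ m ∈ S \ u, S.erase m ∉ L') :
    ∀ y ∈ T, ¬ y ⊆ u → ∃ m ∈ y, m ∉ u ∧
      (diffsX m T ∩ diffsY m T).card = (partner m T).card ∧ (partner m T).Nonempty ∧
      u ∩ Rstar (partner m T) ∈ T := by
  intro y hy hyu
  obtain ⟨m, hmy, hmu⟩ := not_subset.1 hyu
  have hmS : m ∈ S \ u := mem_sdiff.2 ⟨h.hTS y hy hmy, hmu⟩
  exact ⟨m, hmy, hmu, h.nonTightening hnt hmu (hB m hmS),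
    h.partner_nonempty hnt hmu (hB m hmS) hy hmy,
    mem_of_mem_partner (h.inter_Rstar_mem_partner hnt hmu (hB m hmS) hy hmy)⟩

/-- **(BNT) in every residue instance** (Addendum 39, Step 1): `|Λ ∩ 𝒬| ≤ |K⁺|`. -/
theorem card_link_inter_outFaces_le (h : RInst S L' T u) (hnt : ¬ Tight T)
    (hB : ∀ m ∈ S \ u, S.erase m ∉ L') :
    (link (upSet S L') u ∩ outFaces T u).card ≤
      ((T.filter fun y => y ⊆ u) ∩ outFaces T u).card := by
  rw [← outFaces_inter_eq h.subset_upSet h.mem_of_mem_upSet]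
  exact card_link_inter_le_card h.upSet_up (h.exists_subset_rho hnt hB) (h.outside_data hnt hB)

end RInst

end PercRepro.MSTight
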